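import Summits.SmoothPoincare4.SmoothPoincare4.Theses.SymplecticOrigami
import Summits.SmoothPoincare4.SmoothPoincare4.Theorems.OrigamiFoldExistence.Negative.MeanConvexUnwindingCreaseGerm
import Literature.Topology.FourManifolds.HomotopySpheres
import Literature.Topology.FourManifolds.ImmersionOrientation

/-!
# Stub `helper_seamTrace_rank` of line `stable-seam-host` for crux `OrigamiFoldExistence`
(item stmt-SmoothPoincare4-7844, route route-SmoothPoincare4-SymplecticOrigami)

The registered signature, so that the skeleton closes its `helper_seamTrace_rank` by `exact` this
theorem.  Setting: `S` a homotopy `4`-sphere, `e : ℝ⁴ → S` a smooth embedding (a chart ball),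
`J : S → X` a map into a `4`-manifold `X` which is `C^∞`, injective and immersive (bijective
`mfderiv`) on an open set `U ⊇ (e(B̊⁴))ᶜ`, and `Ω` a pointwise nondegenerate `2`-form on `X`.
Claim: for every unit vector `u`, the **seam trace**
`σ_u(v, w) = Ω_{J(e u)}(D(J ∘ e)_u v, D(J ∘ e)_u w)` does not vanish identically on the tangent
space `u^⊥` of the unit sphere, i.e. there are `v, w ⊥ u` with `σ_u(v, w) ≠ 0`.

Proof.
1. `e u ∈ U`: `e` is injective and `u ∉ B̊⁴`, so `e u ∉ e(B̊⁴)`.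
2. `L := D(J ∘ e)_u = DJ_{e u} ∘ De_u` (chain rule) is a bijection `ℝ⁴ → T_{J(e u)} X`: `De_u` is
   injective (immersion, tree lemma
   `Literature.Topology.FourManifolds.injective_mfderiv_of_isImmersionAt'`), hence bijective
   (injective endomorphism of `ℝ⁴`), and `DJ_{e u}` is bijective by hypothesis.
3. Linear algebra (`exists_perp_pair_of_nondegenerate`): the linear map
   `v ↦ (⟪u, v⟫, Ω(L v, L u)) : ℝ⁴ → ℝ²` has a nonzero kernel vector `v₀` (`4 > 2`); `L v₀ ≠ 0`,
   so by nondegeneracy and surjectivity of `L` there is `w` with `Ω(L v₀, L w) ≠ 0`; replacing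
   `w` by its projection `w - ⟪w, u⟫ u ∈ u^⊥` changes `Ω(L v₀, L w)` by
   `-⟪w, u⟫ Ω(L v₀, L u) = 0`.

The bilinearity lemmas in the `![v, w]` spelling are adapted from
`Theorems/SymplecticOrigamiFoldedSphereFoldExistencePfaffian.lean` (stated here for a topological
module, since `TangentSpace (𝓡 4) x` carries no norm instance); steps 1–2 follow
`Cruxes/OrigamiFoldExistence/Disproof.lean` §9, reusing the landed
`Theorems/OrigamiFoldExistence/Negative/MeanConvexUnwindingCreaseGerm.lean`
(`not_mem_image_ball_of_norm_eq_one`, `surjective_of_injective_endo`).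
-/

noncomputable section

-- the prescribed namespace `Summit.<P>.<Sub>.…` duplicates `SmoothPoincare4` (P = Sub)
set_option linter.dupNamespace false

open scoped Manifold ContDiff Topology RealInnerProductSpace
open Set Function

namespace Summit.SmoothPoincare4.SmoothPoincare4.Theorems.OrigamiFoldExistence.StableSeamHost

/-! ### Bilinearity of `2`-forms in the `![v, w]` spelling (topological-module version) -/

section TwoForm

variable {W : Type*} [TopologicalSpace W] [AddCommGroup W] [Module ℝ W]

-- adapted from Theorems/SymplecticOrigamiFoldedSphereFoldExistencePfaffian.lean
/-- Additivity of a `2`-form in its first argument. [folklore] -/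
theorem twoForm_add_left (α : W [⋀^Fin 2]→L[ℝ] ℝ) (x y w : W) :
    α ![x + y, w] = α ![x, w] + α ![y, w] :=
  α.toContinuousMultilinearMap.cons_add _ _ _

/-- Homogeneity of a `2`-form in its first argument. [folklore] -/
theorem twoForm_smul_left (α : W [⋀^Fin 2]→L[ℝ] ℝ) (c : ℝ) (x w : W) :
    α ![c • x, w] = c * α ![x, w] :=
  α.toContinuousMultilinearMap.cons_smul _ _ _

/-- Antisymmetry of a `2`-form. [folklore] -/
theorem twoForm_swap (α : W [⋀^Fin 2]→L[ℝ] ℝ) (v w : W) : α ![v, w] = -α ![w, v] := by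
  classical
  have h := α.map_swap ![w, v] (show (0 : Fin 2) ≠ 1 by decide)
  have hs : (![w, v] ∘ Equiv.swap (0 : Fin 2) 1) = ![v, w] := by
    funext i
    fin_cases i <;> rfl
  rw [hs] at h
  exact h

/-- Additivity of a `2`-form in its second argument. [folklore] -/
theorem twoForm_add_right (α : W [⋀^Fin 2]→L[ℝ] ℝ) (v x y : W) :
    α ![v, x + y] = α ![v, x] + α ![v, y] := by
  rw [twoForm_swap α v, twoForm_add_left, twoForm_swap α v x, twoForm_swap α v y]
  ring

/-- Homogeneity of a `2`-form in its second argument. [folklore] -/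
theorem twoForm_smul_right (α : W [⋀^Fin 2]→L[ℝ] ℝ) (c : ℝ) (v x : W) :
    α ![v, c • x] = c * α ![v, x] := by
  rw [twoForm_swap α v, twoForm_smul_left, twoForm_swap α v x]
  ring

end TwoForm

/-! ### The linear-algebra core -/

/-- **A nondegenerate alternating form, pulled back by a linear bijection, does not vanish on a
hyperplane `u^⊥` of a space of dimension `> 2`.** If `α` is a `2`-form on `W` with trivial
radical, `L : V → W` a linear bijection from a finite-dimensional real inner product space `V` with
`2 < dim V`, and `u` a unit vector, then `α(L v, L w) ≠ 0` for some `v, w ⊥ u`. (The kernel of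
`v ↦ (⟪u, v⟫, α(L v, L u))` is nonzero; pair a kernel vector, via nondegeneracy, with some `L w`,
and project `w` to `u^⊥`.) [folklore] -/
theorem exists_perp_pair_of_nondegenerate
    {V : Type*} [NormedAddCommGroup V] [InnerProductSpace ℝ V] [FiniteDimensional ℝ V]
    {W : Type*} [TopologicalSpace W] [AddCommGroup W] [Module ℝ W]
    (α : W [⋀^Fin 2]→L[ℝ] ℝ) (L : V →ₗ[ℝ] W) (hL : Bijective L)
    (hα : ∀ a : W, a ≠ 0 → ∃ b : W, α ![a, b] ≠ 0) (hV : 2 < Module.finrank ℝ V)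
    (u : V) (hu : ‖u‖ = 1) :
    ∃ v w : V, ⟪v, u⟫ = 0 ∧ ⟪w, u⟫ = 0 ∧ α ![L v, L w] ≠ 0 := by
  classical
  -- the linear map `g v = (⟪u, v⟫, α ![L v, L u])` to `ℝ × ℝ` has a nonzero kernel vector
  let φ : V →ₗ[ℝ] ℝ :=
    { toFun := fun v => α ![L v, L u]
      map_add' := fun v w => by rw [map_add, twoForm_add_left]
      map_smul' := fun c v => by
        simp only [RingHom.id_apply, smul_eq_mul]
        rw [map_smul, twoForm_smul_left] }
  let g : V →ₗ[ℝ] ℝ × ℝ := (innerₛₗ ℝ u).prod φ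
  have hlt : Module.finrank ℝ (ℝ × ℝ) < Module.finrank ℝ V := by simpa using hV
  have hker : LinearMap.ker g ≠ ⊥ := LinearMap.ker_ne_bot_of_finrank_lt hlt
  obtain ⟨v₀, hv₀, hv₀ne⟩ := Submodule.exists_mem_ne_zero_of_ne_bot hker
  have hg : g v₀ = 0 := LinearMap.mem_ker.mp hv₀
  have huv₀ : ⟪u, v₀⟫ = 0 := by
    have h := congrArg Prod.fst hg
    simpa [g] using h
  have hφ : α ![L v₀, L u] = 0 := by
    have h := congrArg Prod.snd hg
    simpa [g, φ] using h
  -- nondegeneracy at `L v₀ ≠ 0`, then surjectivity of `L`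
  have hLv₀ : L v₀ ≠ 0 := fun h => hv₀ne (hL.1 (h.trans (map_zero L).symm))
  obtain ⟨b, hb⟩ := hα (L v₀) hLv₀
  obtain ⟨w, rfl⟩ := hL.2 b
  -- project `w` to `u^⊥`
  refine ⟨v₀, w - ⟪w, u⟫ • u, ?_, ?_, ?_⟩
  · rw [real_inner_comm]
    exact huv₀
  · rw [inner_sub_left, real_inner_smul_left, real_inner_self_eq_norm_sq, hu]
    ring
  · have h1 : L (w - ⟪w, u⟫ • u) = L w + (-⟪w, u⟫) • L u := by
      rw [map_sub, map_smul, neg_smul, sub_eq_add_neg]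
    rw [h1, twoForm_add_right, twoForm_smul_right, hφ, mul_zero, add_zero]
    exact hb

/-! ### The stub -/

/-- **Stub `helper_seamTrace_rank` (the seam trace has rank `2` on `u^⊥`).** For a smooth
embedding `e : ℝ⁴ → S` of a homotopy `4`-sphere, a map `J : S → X` that is `C^∞`, injective and
immersive on an open set containing the fake ball `(e(B̊⁴))ᶜ`, and a pointwise nondegenerate
`2`-form `Ω` on `X`, at every unit vector `u` there are `v, w ⊥ u` with
`Ω_{J(e u)}(D(J ∘ e)_u v, D(J ∘ e)_u w) ≠ 0`. -/
theorem helper_seamTrace_rank :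
    ∀ (S : Literature.Topology.FourManifolds.HomotopySphere 4) (e : EuclideanSpace ℝ (Fin 4) → S.carrier) (X : Type) [TopologicalSpace X] [T2Space X] [SecondCountableTopology X] [ChartedSpace (EuclideanSpace ℝ (Fin 4)) X] [IsManifold (𝓡 4) ∞ X] (Ω : Literature.Geometry.Kaehler.MForm (𝓡 4) X ℝ 2) (J : S.carrier → X), Manifold.IsSmoothEmbedding (𝓡 4) (𝓡 4) ∞ e → (∀ x (v : TangentSpace (𝓡 4) x), v ≠ 0 → ∃ w, Ω x ![v, w] ≠ 0) → (∃ U : Set S.carrier, IsOpen U ∧ (e '' Metric.ball (0 : EuclideanSpace ℝ (Fin 4)) 1)ᶜ ⊆ U ∧ ContMDiffOn (𝓡 4) (𝓡 4) ∞ J U ∧ Set.InjOn J U ∧ ∀ x ∈ U, Function.Bijective (mfderiv (𝓡 4) (𝓡 4) J x)) → ∀ u : EuclideanSpace ℝ (Fin 4), ‖u‖ = 1 → ∃ v w : EuclideanSpace ℝ (Fin 4), ⟪v, u⟫ = 0 ∧ ⟪w, u⟫ = 0 ∧ Ω ((J ∘ e) u) ![mfderiv (𝓡 4) (𝓡 4)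 (J ∘ e) u v, mfderiv (𝓡 4) (𝓡 4) (J ∘ e) u w] ≠ 0 := by
  intro S e X _ _ _ _ _ Ω J he hΩ hJ u hu
  obtain ⟨U, hUo, hUsub, hJU, -, hJbij⟩ := hJ
  -- (1) `e u ∈ U`
  have heU : e u ∈ U :=
    hUsub (Negative.not_mem_image_ball_of_norm_eq_one he.isEmbedding.injective hu)
  -- (2) chain rule; `L = D(J ∘ e)_u` is bijective
  have h1 : MDifferentiableAt (𝓡 4) (𝓡 4) e u := (he.contMDiff u).mdifferentiableAt (by simp)
  have h2 : MDifferentiableAt (𝓡 4) (𝓡 4) J (e u) :=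
    (hJU.contMDiffAt (hUo.mem_nhds heU)).mdifferentiableAt (by simp)
  have hcomp : mfderiv (𝓡 4) (𝓡 4) (J ∘ e) u =
      (mfderiv (𝓡 4) (𝓡 4) J (e u)).comp (mfderiv (𝓡 4) (𝓡 4) e u) :=
    mfderiv_comp u h2 h1
  have hLe_inj : Injective (mfderiv (𝓡 4) (𝓡 4) e u) :=
    Literature.Topology.FourManifolds.injective_mfderiv_of_isImmersionAt'
      (he.isImmersion.isImmersionAt u)
  have hLe_surj : Surjective (mfderiv (𝓡 4) (𝓡 4) e u) :=
    Negative.surjective_of_injective_endo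
      ((mfderiv (𝓡 4) (𝓡 4) e u).toLinearMap :
        EuclideanSpace ℝ (Fin 4) →ₗ[ℝ] EuclideanSpace ℝ (Fin 4)) hLe_inj
  have hLbij : Bijective (mfderiv (𝓡 4) (𝓡 4) (J ∘ e) u) := by
    rw [hcomp]
    exact (hJbij _ heU).comp ⟨hLe_inj, hLe_surj⟩
  -- (3) linear algebra at `x = J (e u)`
  have hfin : 2 < Module.finrank ℝ (EuclideanSpace ℝ (Fin 4)) := by simp
  obtain ⟨v, w, hv, hw, hne⟩ := exists_perp_pair_of_nondegenerate (Ω ((J ∘ e) u))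
    ((mfderiv (𝓡 4) (𝓡 4) (J ∘ e) u).toLinearMap :
      EuclideanSpace ℝ (Fin 4) →ₗ[ℝ] TangentSpace (𝓡 4) ((J ∘ e) u))
    hLbij (hΩ ((J ∘ e) u)) hfin u hu
  exact ⟨v, w, hv, hw, hne⟩

end Summit.SmoothPoincare4.SmoothPoincare4.Theorems.OrigamiFoldExistence.StableSeamHost

end
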